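import Literature.AnabelianGeometry.SemiGraphs.ArithLevelDataCptCompact
import Literature.AnabelianGeometry.SemiGraphs.ArithLevelDataCptOfCosetTowerC
import HarnessLib

/-!
# [SemiAnbd] Rmk 5.3.1 / Thm 5.4: `hVc` / `hBc` AT THE COSET-GRAPH TOWER PACKAGE WITH THE COMPACT-FORM
# ESTRANGEMENT INPUT (`ArithLevelDataCpt.ofCosetTowerC`) — twin instantiation

Mochizuki, *Semi-graphs of anabelioids*, Publ. RIMS **42** (2006) 221–322, §5: Rmk 5.3.1 p. 65 ("all
verticial and edge-like subgroups of `Π^temp_𝔊` are compact"), p. 65 data, Thm 5.4 (i)(ii) p. 66, proof of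
Thm 3.7 (iii) p. 41. [cite: MochizukiSemiAnbd2006, Rmk 5.3.1, p. 65]

PROOF-ONLY (abc-iut cell, L3 sub-DAG `plan/L3/SUBDAG-SemiAnbd-Thm54.md`, producer row T54-B sub-piece
«hVc/hBc-inst», seat abc-iut-w4-d040 gen 3).  No definition, no new named fact.  The literal
instantiation `hVc_hBc_of_cosetTower` of ArithLevelDataCptCompact.lean (p427849), REPEATED VERBATIM at
abc-iut-w4-d029's twin constructor `ArithLevelDataCpt.ofCosetTowerC` (ArithLevelDataCptOfCosetTowerC.lean,
p428611; finding F-d029g3-1: the estrangement binder `hnobpN` in the compact-subgroups form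
`∀ C, IsCompact ↑C → …`) — the package the T54-B capstone (abc-iut-w4-d029,
ArithThm54iCapstoneOuterAction.lean) is built on:

* `ProfiniteSemiGraph.hVc_hBc_of_cosetTowerC` — `(∀ v, IsCompact (arithVertGp R ι v)) ∧
  ∀ b, IsCompact (arithBrGp R ι b)` at `Lc := ArithLevelDataCpt.ofCosetTowerC …` (binders verbatim), from
  the generic `hVc_of_hfin` / `hBc_of_hfin` and `hfin_of_cosetTower` (the tree/act fields of the twin
  unfold definitionally to `P.cosetGraph (K j)` / `P.arithAct hP (K j)` exactly as for the original),
  modulo: `E` tempered with basis `levelKer (K n) ⊓ aug⁻¹ U`, `Π_A` compact, `ker aug ≤ range ι`, `hK1′`,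
  the tree levels `K n` open in `Π^temp_𝒢`.

Nothing here takes a side on [IUTchIII] Cor. 3.12; typed ≠ proved for the packages themselves.
-/

namespace Literature.AnabelianGeometry.SemiGraphs

open CategoryTheory Topology Filter
open scoped Pointwise

universe v u w

namespace ProfiniteSemiGraph

/-- **`hVc` ∧ `hBc` for the PRODUCED decomposition data over the COMPACT-FORM coset-graph tower package
`ArithLevelDataCpt.ofCosetTowerC`** (abc-iut-w4-d029 p428611; binders verbatim, `hnobpN` in the form
`∀ C, IsCompact ↑C → …`): every `arithVertGp R ι v` and `arithBrGp R ι b` is compact, modulo exactly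
`E` tempered with abc-iut-L3-d2's basis `levelKer (K n) ⊓ aug⁻¹ U`, `Π_A` compact, `ker aug ≤ range ι`, the
continuity binder `hK1′`, and the tree levels `K n` open in `Π^temp_𝒢` — the binders `hVc`/`hBc` of the
Thm 5.4 (i)∧(ii) umbrella at this package ([SemiAnbd] Rmk 5.3.1 p. 65).
[cite: MochizukiSemiAnbd2006, Rmk 5.3.1, p. 65] -/
theorem hVc_hBc_of_cosetTowerC {𝒢 : ProfiniteSemiGraph.{u}} (c : TemperedPiChart 𝒢)
    (h𝒢 : 𝒢.Thm37Hypotheses) (hG : 𝒢.graph.IsGraph) [Finite 𝒢.graph.Vertex] [Finite 𝒢.graph.Branch]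
    (R : ChartRepresentatives c)
    {E : Type w} [Group E] [TopologicalSpace E] [IsTopologicalGroup E] {PA : Type v} [Group PA]
    [TopologicalSpace PA] [IsTopologicalGroup PA] [CompactSpace PA]
    (ι : c.G →* E) (hι : Function.Injective ι) (hnorm : (ι.range).Normal)
    (aug : E →* PA) (baseAct : PA →* Aut 𝒢.graph)
    -- the subgroup presentation and its compatibility with the outer action (abc-iut-L3-d4)
    (P : SemiGraph.SubgroupPresentation 𝒢.graph c.G) {Φ : E →* MulAut c.G}
    (hP : P.IsArithCompatible Φ (baseAct.comp aug))
    (hιΦ : ∀ g : c.G, Φ (ι g) = MulAut.conj g) (hισ : ∀ g : c.G, (baseAct.comp aug) (ι g) = 1)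
    (hPH : ∀ w, P.H w ∈ verticialSubgroups c w) (hPM : ∀ e, P.M e ∈ edgeLikeSubgroups c e)
    (w₀ : 𝒢.graph.Vertex)
    -- the tree levels
    (K : ℕ → Subgroup c.G) [∀ j, (K j).Normal] (hK : ∀ ⦃i j : ℕ⦄, i ≤ j → K j ≤ K i)
    (hKst : ∀ (j : ℕ) (e : E) (x : c.G), x ∈ K j → Φ e x ∈ K j)
    (hT : ∀ j, (P.cosetGraph (K j)).IsTree)
    (hKopen : ∀ j, IsOpen ((P.arithAct hP (K j) (hKst j)).ker : Set E))
    -- Thm 5.4's printed frame hypothesis on the base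
    (noSwitchBase : NoBranchSwitching 𝒢.graph.edgeOf
      (fun (a : PA) (b : 𝒢.graph.Branch) => (baseAct a).hom.branchMap b))
    -- abc-iut-w4-d059's dict2 algebraic tower inputs (topological discharge: abc-iut-w4-d085 (P-K))
    (hHK : ∀ (w : 𝒢.graph.Vertex) (x : c.G), (∀ j, x ∈ (P.H w : Set c.G) * (K j : Set c.G)) → x ∈ P.H w)
    (hMK : ∀ (e : 𝒢.graph.Edge) (x : c.G), (∀ j, x ∈ (P.M e : Set c.G) * (K j : Set c.G)) → x ∈ P.M e)
    (hlift : ∀ (w : 𝒢.graph.Vertex) (y : ℕ → c.G),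
      (∀ ⦃i j : ℕ⦄, i ≤ j →
        DoubleCoset.mk (P.H w) (K i) (y j) = DoubleCoset.mk (P.H w) (K i) (y i)) →
      ∃ z : c.G, ∀ j, DoubleCoset.mk (P.H w) (K j) z = DoubleCoset.mk (P.H w) (K j) (y j))
    (hliftE : ∀ (j₁ : ℕ) (e : 𝒢.graph.Edge) (y : {j : ℕ // j₁ ≤ j} → c.G),
      (∀ ⦃i j : {j : ℕ // j₁ ≤ j}⦄, i.1 ≤ j.1 →
        DoubleCoset.mk (P.M e) (K i.1) (y j) = DoubleCoset.mk (P.M e) (K i.1) (y i)) →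
      ∃ z : c.G, ∀ j, DoubleCoset.mk (P.M e) (K j.1) z = DoubleCoset.mk (P.M e) (K j.1) (y j))
    -- the finite levels
    (L : ℕ → Subgroup c.G) [∀ j, (L j).Normal] [∀ j, Finite (c.G ⧸ L j)]
    (hL : ∀ ⦃i j : ℕ⦄, i ≤ j → L j ≤ L i)
    (hLst : ∀ (j : ℕ) (e : E) (x : c.G), x ∈ L j → Φ e x ∈ L j) (hKL : ∀ j, K j ≤ L j)
    (hfree : ∀ (j : ℕ) (w : 𝒢.graph.Vertex) (z x : c.G), x ∈ L j → z * x * z⁻¹ ∈ P.H w → x ∈ K j)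
    -- the estrangement consequence at the finite levels (abc-iut-L3-t11's shape)
    (hnobpN : ∀ (C : Subgroup c.G), IsCompact (C : Set c.G) →
      ∀ (j₀ : ℕ) (w : ∀ i : {i : ℕ // j₀ ≤ i}, (P.cosetGraph (L i.1)).Vertex)
      (β β' : ∀ i : {i : ℕ // j₀ ≤ i}, (P.cosetGraph (L i.1)).Branch),
      (∀ i, β i ≠ β' i ∧ (P.cosetGraph (L i.1)).abuts (β i) = some (w i) ∧
        (P.cosetGraph (L i.1)).abuts (β' i) = some (w i)) →
      (∀ ⦃i i' : {i : ℕ // j₀ ≤ i}⦄ (h : i.1 ≤ i'.1), (P.cosetGraphTrans (hL h)).vertexMap (w i') = w i ∧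
        (P.cosetGraphTrans (hL h)).branchMap (β i') = β i ∧
          (P.cosetGraphTrans (hL h)).branchMap (β' i') = β' i) →
      (∀ (i : {i : ℕ // j₀ ≤ i}) (γ : C), (P.arithAct hP (L i.1) (hLst i.1) (ι γ)).hom.vertexMap (w i) = w i ∧
        (P.arithAct hP (L i.1) (hLst i.1) (ι γ)).hom.branchMap (β i) = β i ∧
          (P.arithAct hP (L i.1) (hLst i.1) (ι γ)).hom.branchMap (β' i) = β' i) → C = ⊥)
    -- (AI4″) at the finite levels (abc-iut-w4-d059, producer)
    (stabBranchPairAug : ∀ (C : Subgroup E), IsCompact (C : Set E) →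
      ∀ (j₀ : ℕ) (w : ∀ i : {i : ℕ // j₀ ≤ i}, (P.cosetGraph (L i.1)).Vertex)
      (β β' : ∀ i : {i : ℕ // j₀ ≤ i}, (P.cosetGraph (L i.1)).Branch),
      (∀ i, β i ≠ β' i ∧ (P.cosetGraph (L i.1)).abuts (β i) = some (w i) ∧
        (P.cosetGraph (L i.1)).abuts (β' i) = some (w i)) →
      (∀ ⦃i i' : {i : ℕ // j₀ ≤ i}⦄ (h : i.1 ≤ i'.1), (P.cosetGraphTrans (hL h)).vertexMap (w i') = w i ∧
        (P.cosetGraphTrans (hL h)).branchMap (β i') = β i ∧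
          (P.cosetGraphTrans (hL h)).branchMap (β' i') = β' i) →
      (∀ (i : {i : ℕ // j₀ ≤ i}) (g : E), g ∈ C →
        (P.arithAct hP (L i.1) (hLst i.1) g).hom.vertexMap (w i) = w i ∧
        (P.arithAct hP (L i.1) (hLst i.1) g).hom.branchMap (β i) = β i ∧
          (P.arithAct hP (L i.1) (hLst i.1) g).hom.branchMap (β' i) = β' i) →
      ∃ (v : 𝒢.graph.Vertex) (b b' : 𝒢.graph.Branch) (a : PA) (h : E),
        (decompositionDataOfChart R ι).abut b = some v ∧ (decompositionDataOfChart R ι).abut b' = some v ∧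
        h ∈ (decompositionDataOfChart R ι).vertGp v ∧ (b' ≠ b ∨ h ∉ (decompositionDataOfChart R ι).brGp b) ∧
        C.map aug ≤ conjSubgroup a (((decompositionDataOfChart R ι).brGp b ⊓
          conjSubgroup h ((decompositionDataOfChart R ι).brGp b')).map aug))
    -- the LEVEL-B topology: tempered `E` with abc-iut-L3-d2's basis, exactness, `hK1′`, open tree levels
    (hE : IsTempered E)
    (hb : (𝓝 (1 : E)).HasBasis (fun _ : ℕ × OpenNormalSubgroup PA => True)
      (fun nU => ((P.levelKer hP (K nU.1) (hKst nU.1) ⊓ nU.2.toSubgroup.comap aug : Subgroup E) :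
        Set E)))
    (hexact : aug.ker ≤ ι.range)
    (hK1' : ∀ n, IsOpen (((P.levelKer hP (K n) (hKst n)).map aug : Subgroup PA) : Set PA))
    (hKopen' : ∀ n, IsOpen (K n : Set c.G)) :
    (∀ v, IsCompact (arithVertGp R ι v : Set E)) ∧ ∀ b, IsCompact (arithBrGp R ι b : Set E) := by
  have hHc : ∀ w : 𝒢.graph.Vertex, IsCompact (P.H w : Set c.G) := fun w =>
    isCompact_of_mem_verticialSubgroups c (hPH w)
  have hfin := P.hfin_of_cosetTower hP aug ι hιΦ hισ K hKst hKopen' hexact hK1' hHc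
  refine ⟨fun v => hVc_of_hfin R ι (ArithLevelDataCpt.ofCosetTowerC c h𝒢 hG R ι hι hnorm aug baseAct P hP
      hιΦ hισ hPH hPM w₀ K hK hKst hT hKopen noSwitchBase hHK hMK hlift hliftE L hL hLst hKL hfree hnobpN
      stabBranchPairAug) hE hb hfin v,
    fun b => hBc_of_hfin R ι (ArithLevelDataCpt.ofCosetTowerC c h𝒢 hG R ι hι hnorm aug baseAct P hP
      hιΦ hισ hPH hPM w₀ K hK hKst hT hKopen noSwitchBase hHK hMK hlift hliftE L hL hLst hKL hfree hnobpN
      stabBranchPairAug) hE hb hfin hG b⟩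

end ProfiniteSemiGraph

end Literature.AnabelianGeometry.SemiGraphs
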